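import Summits.MatrixMultiplication.MatrixMultiplication.Theorems.ObstructionDescentRankMethodsBlind
import Summits.MatrixMultiplication.MatrixMultiplication.Theorems.ObstructionDescentCornerEquations
import Literature.Computability.AlgebraicComplexity.KroneckerPowMarginals
import Literature.Barriers.MatrixMultiplication.LinearRankMethodBarrierProofs

/-!
# Kronecker-power rank methods are blind on `GL_m³·pad_m⟨n,n,n⟩` past the power-format cactus wall
(decomp-mm · lens 3 · gen 21; method axis of `E = NoPolyDegreeObstruction`, rung R2^⊠)

Route `route-MatrixMultiplication-ObstructionDescent` (`ω(ℂ) = 2`).  Rung R2 (item 30921, closed) says that LINEAR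
rank methods `L : ℂ^{m³} → Mat` with `rk L ≤ ρ` on rank-one tensors (subadditive threshold `ρ·m` on `σ_m`) are blind
on the `GL_m³`-orbit of `pad_m⟨n,n,n⟩` past the cactus wall `m ≥ 6n² − 4`.  This file climbs one rung up the
METHOD axis: the **Kronecker-power rank methods of degree `k`** — a linear map `L` on the `k`-th Kronecker-power
format `((ℂ^m)^{⊗k})^{⊗3}` (index type `Fin k → Fin m` in each factor) with `rk L ≤ ρ` on the rank-one tensors
`w ⊗ u ⊗ v` of that (coarse, three-factor) format, applied to `T^{⊠k}`; since `T^{⊠k} ∈ σ_{m^k}` whenever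
`T ∈ σ_m`, the method certifies `bR(T) > m` as soon as `rk L(T^{⊠k}) > ρ·m^k` (SUBMULTIPLICATIVE threshold).
Every homogeneous degree-`k` polynomial matrix map `T ↦ M(T)` factors as `Λ(T^{⊠k})` with `Λ` linear (the entries
of `T^{⊠k}` are all degree-`k` monomials in the entries of `T`), so this is the class of ALL degree-`k` polynomial
rank methods normalised by the `σ_{m^k}`-threshold — it contains the square / higher Kronecker powers of Strassen's
commutator and of the Koszul–Young flattenings, and the "naive" Kronecker–Koszul maps `u ↦ flatten(π(u ⊗ J))` of
Doležálek–Michałek 2026 (§3: `J` auxiliary, `π` a fixed contraction; `u ↦ L(u ⊠ J)` is again linear in `u`).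

* `rank_apply_kroneckerPow_actTensor_padMM_le` — **the power-format cactus bound**: for ALL `A, B, C ∈ Mat_m`,
  `rk L(((A,B,C)·pad_m⟨n,n,n⟩)^{⊠k}) ≤ ρ·(6n^{2k} − 4)` (`n ≥ 1`).  Proof: `(A,B,C)·pad_m t = (AE, BE, CE)·t`
  with `E` the `0/1` padding matrix (`padTensor_eq_actTensor`, `actTensor_actTensor`); Kronecker powers commute
  with the action (`kroneckerPow_actTensor_powMat`: `((A',B',C')·t)^{⊠k} = (A'^{⊗k},B'^{⊗k},C'^{⊗k})·t^{⊠k}`); so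
  `L ∘ [(AE)^{⊗k} ⊗ (BE)^{⊗k} ⊗ (CE)^{⊗k}]` is a LINEAR rank method on the three-factor format
  `(ℂ^{n^{2k}})^{⊗3}` of `⟨n,n,n⟩^{⊠k}` with the same `ρ` (triads go to triads, `actTensor_triad`), and there the
  tree's THEOREM `Literature.Barriers.MatrixMultiplication.Buczynski2026_cactusBarrier_segre_holds` (Buczyński's
  cactus barrier: the cactus variety `𝔎_{2(a+b+c−2)}` of `Seg(ℙ^{a-1}×ℙ^{b-1}×ℙ^{c-1})` fills) bounds it on
  every tensor, in particular on `⟨n,n,n⟩^{⊠k}`.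
* `kroneckerRankMethodsBlind` — **rung R2^⊠**: past the wall `6n^{2k} − 4 ≤ m^k` (i.e. `m ≥ 6^{1/k}·n²`; met in
  every cell `m ≥ n^τ, τ > 2` of `E` for `n` large) the bound is `≤ ρ·m^k`, the maximum the method takes on
  `σ_m`: NO Kronecker-power rank method of ANY degree `k` separates `GL_m³·pad_m⟨n,n,n⟩` from `σ_m` at quadratic
  scale.  `k = 1` is item 30921 verbatim (`t^{⊠1} ≅ t`); the statement is the text of the route's aside item
  `KroneckerRankMethodsBlind` (gen 21), with the pad spelled inline exactly as in the route file, so the item closes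
  by `id`/`rfl` against this theorem once the gate has written the decl.
* `kroneckerRankMethodsBlind_of_six_pow_le` — the same past the coarser wall `6n^{2k} ≤ m^k`.

Scope (honest): the hypothesis is the COARSE rank-one bound (`w ⊗ u ⊗ v` with `w, u, v ∈ (ℂ^m)^{⊗k}` arbitrary),
which is what the submultiplicative threshold `ρ·m^k` uses; a method normalised by its FINE rank-one bound `ρ_f ≤ ρ`
(`w = w₁ ⊗ ⋯ ⊗ w_k`, …) is covered up to the factor `ρ/ρ_f` — for the Kronecker–Koszul shapes of Doležálek–Michałek
(fixed `k`, `λ`, `d'`) that factor is `∏ C(m,d')/C(m−|λ|,d') = O_shape(1)`, so those too are blind for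
`m ≥ C_shape·n²`; the OPTIMALLY normalised class (threshold `max_{σ_m} rk M`) is all of `E` by Valiant universality
and is not claimed.  One definition (`padMat`, the `0/1` padding matrix); sorry-free; standard axioms.
[cite: Buczynski2026, Thm. 2 / Cor. 13 / §1.5; DolezalekMichalek2026, §3 (Thm. 3.3, Def. 3.4, Cor. 3.5) and §5.1;
GargMakamOliveiraWigderson2019, §1.4 and Thm. 1.14; EfremenkoGargOliveiraWigderson2018, Thm. 4.4;
LandsbergGCT2017, §10.2.2; BurgisserIkenmeyer2011, §2 and §5]
-/

set_option linter.dupNamespace false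
set_option autoImplicit false

noncomputable section

open scoped BigOperators

namespace Summit.MatrixMultiplication.MatrixMultiplication.Theorems.ObstructionDescentKroneckerRankMethods

open Literature.Computability.AlgebraicComplexity (actTensor actTensor_apply matMulTensor triad actTensor_triad
  actTensor_zero kroneckerPow kroneckerPow_apply powMat kroneckerPow_actTensor_powMat actTensor_actTensor)
open Summit.MatrixMultiplication.MatrixMultiplication.Theorems.ObstructionCalculus (Tensor padTensor padIdx padMM)
open Summit.MatrixMultiplication.MatrixMultiplication.Theorems.ObstructionDescentCornerEquations (padTensor_eq_actTensor)
open Summit.MatrixMultiplication.MatrixMultiplication.Theorems.ObstructionDescentRankMethodsBlind (padMM_zero)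

/-! ## §1 The rectangular action is linear; powers of the zero tensor -/

/-- The action `(A ⊗ B ⊗ C)·t` (rectangular `A, B, C`) is additive in `t`. [folklore] -/
theorem actTensor_add_rect {ι κ μ ι' κ' μ' : Type} [Fintype ι] [Fintype κ] [Fintype μ] (A : Matrix ι' ι ℂ)
    (B : Matrix κ' κ ℂ) (C : Matrix μ' μ ℂ) (s t : ι → κ → μ → ℂ) :
    actTensor A B C (s + t) = actTensor A B C s + actTensor A B C t := by
  funext a b c
  simp only [actTensor_apply, Pi.add_apply, mul_add, Finset.sum_add_distrib]

/-- The action `(A ⊗ B ⊗ C)·t` (rectangular `A, B, C`) commutes with scalars. [folklore] -/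
theorem actTensor_smul_rect {ι κ μ ι' κ' μ' : Type} [Fintype ι] [Fintype κ] [Fintype μ] (A : Matrix ι' ι ℂ)
    (B : Matrix κ' κ ℂ) (C : Matrix μ' μ ℂ) (z : ℂ) (t : ι → κ → μ → ℂ) :
    actTensor A B C (z • t) = z • actTensor A B C t := by
  funext a b c
  simp only [actTensor_apply, Pi.smul_apply, smul_eq_mul, Finset.mul_sum]
  exact Finset.sum_congr rfl fun a' _ => Finset.sum_congr rfl fun b' _ =>
    Finset.sum_congr rfl fun c' _ => by ring

/-- `0^{⊠k} = 0` for `k ≥ 1`. [folklore] -/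
theorem kroneckerPow_zero_tensor {ι κ μ : Type} (k : ℕ) (hk : 1 ≤ k) :
    kroneckerPow (0 : ι → κ → μ → ℂ) k = 0 := by
  funext a b c
  rw [kroneckerPow_apply]
  exact Finset.prod_eq_zero (Finset.mem_univ (⟨0, hk⟩ : Fin k)) rfl

/-- `t^{⊠0}` is the triad `1 ⊗ 1 ⊗ 1` on the one-point format. [folklore] -/
theorem kroneckerPow_zero_eq_triad {ι κ μ : Type} (t : ι → κ → μ → ℂ) :
    kroneckerPow t 0 = triad (fun _ => (1 : ℂ)) (fun _ => 1) (fun _ => 1) := by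
  funext a b c
  simp [kroneckerPow]

/-! ## §2 The power-format cactus bound on the pad -/

/-- The `0/1` padding matrix `E ∈ ℂ^{m × n²}` of the index embedding `padIdx : Fin n × Fin n ↪ Fin m`
(`E_{a,i} = [padIdx i = a]`), so that `pad_m t = (E,E,E)·t` (`padTensor_eq_actTensor`). [cite: BurgisserIkenmeyer2011, §2] -/
def padMat {n m : ℕ} (h : n * n ≤ m) : Matrix (Fin m) (Fin n × Fin n) ℂ :=
  fun a i => if padIdx n m h i = a then (1 : ℂ) else 0

/-- **The corner action on the pad is a rectangular action on `⟨n,n,n⟩`**: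
`(A,B,C)·pad_m⟨n,n,n⟩ = (AE, BE, CE)·⟨n,n,n⟩` with `E ∈ ℂ^{m × n²}` the `0/1` padding matrix.
[cite: BurgisserIkenmeyer2011, §2] -/
theorem actTensor_padMM_eq {n m : ℕ} (h : n * n ≤ m) (A B C : Matrix (Fin m) (Fin m) ℂ) :
    actTensor A B C (padMM ℂ n m h) =
      actTensor (A * padMat h) (B * padMat h) (C * padMat h) (matMulTensor ℂ n n n) := by
  change actTensor A B C (padTensor (padIdx n m h) (matMulTensor ℂ n n n)) = _
  rw [padTensor_eq_actTensor, actTensor_actTensor]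
  rfl

/-- **The power-format cactus bound on `GL_m³·pad_m⟨n,n,n⟩`**: a linear map `L` on the `k`-th Kronecker-power
format `((ℂ^m)^{⊗k})^{⊗3}` with `rk L ≤ ρ` on the rank-one tensors of that three-factor format has
`rk L(((A,B,C)·pad_m⟨n,n,n⟩)^{⊠k}) ≤ ρ·(6n^{2k} − 4)` for ALL `A, B, C ∈ Mat_m` (`n ≥ 1`):
`((A,B,C)·pad_m⟨n,n,n⟩)^{⊠k} = ((AE)^{⊗k},(BE)^{⊗k},(CE)^{⊗k})·⟨n,n,n⟩^{⊠k}`, the composite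
`L ∘ [(AE)^{⊗k} ⊗ (BE)^{⊗k} ⊗ (CE)^{⊗k}]` is a linear rank method on `(ℂ^{n^{2k}})^{⊗3}` with the same `ρ`, and
there Buczyński's cactus barrier (`𝔎_{6n^{2k}−4}` fills) bounds it on every tensor.
[cite: Buczynski2026, Thm. 2 / Cor. 13; DolezalekMichalek2026, §3; LandsbergGCT2017, §10.2.2] -/
theorem rank_apply_kroneckerPow_actTensor_padMM_le {k n m : ℕ} (hn : 1 ≤ n) (h : n * n ≤ m) {p q ρ : ℕ}
    (L : ((Fin k → Fin m) → (Fin k → Fin m) → (Fin k → Fin m) → ℂ) →ₗ[ℂ] Matrix (Fin p) (Fin q) ℂ)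
    (hρ : ∀ w u v : (Fin k → Fin m) → ℂ, (L (triad w u v)).rank ≤ ρ) (A B C : Matrix (Fin m) (Fin m) ℂ) :
    (L (kroneckerPow (actTensor A B C (padMM ℂ n m h)) k)).rank ≤ ρ * (6 * n ^ (2 * k) - 4) := by
  classical
  rw [actTensor_padMM_eq h A B C, kroneckerPow_actTensor_powMat]
  set A' : Matrix (Fin k → Fin m) (Fin k → Fin n × Fin n) ℂ := powMat (A * padMat h) k with hA'
  set B' : Matrix (Fin k → Fin m) (Fin k → Fin n × Fin n) ℂ := powMat (B * padMat h) k with hB'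
  set C' : Matrix (Fin k → Fin m) (Fin k → Fin n × Fin n) ℂ := powMat (C * padMat h) k with hC'
  let Ψ : ((Fin k → Fin n × Fin n) → (Fin k → Fin n × Fin n) → (Fin k → Fin n × Fin n) → ℂ) →ₗ[ℂ]
      ((Fin k → Fin m) → (Fin k → Fin m) → (Fin k → Fin m) → ℂ) :=
    { toFun := fun u => actTensor A' B' C' u
      map_add' := fun s t => actTensor_add_rect A' B' C' s t
      map_smul' := fun z t => actTensor_smul_rect A' B' C' z t }
  have hρ' : ∀ w u v : (Fin k → Fin n × Fin n) → ℂ, ((L ∘ₗ Ψ) (triad w u v)).rank ≤ ρ := by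
    intro w u v
    change (L (actTensor A' B' C' (triad w u v))).rank ≤ ρ
    rw [actTensor_triad]
    exact hρ _ _ _
  have hcard : Fintype.card (Fin k → Fin n × Fin n) = n ^ (2 * k) := by
    rw [Fintype.card_fun, Fintype.card_prod, Fintype.card_fin, Fintype.card_fin, pow_mul, sq]
  have h1 : 1 ≤ n ^ (2 * k) := Nat.one_le_pow _ _ hn
  have key := Literature.Barriers.MatrixMultiplication.Buczynski2026_cactusBarrier_segre_holds
    (n ^ (2 * k)) (n ^ (2 * k)) (n ^ (2 * k)) h1 h1 h1 hcard hcard hcard p q (L ∘ₗ Ψ) ρ hρ'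
    (kroneckerPow (matMulTensor ℂ n n n) k)
  have e : 2 * (n ^ (2 * k) + n ^ (2 * k) + n ^ (2 * k) - 2) = 6 * n ^ (2 * k) - 4 := by omega
  rw [e] at key
  exact key

/-! ## §3 Rung R2^⊠: Kronecker-power rank methods are blind at quadratic scale -/

/-- **Rung R2^⊠ (the route's aside `KroneckerRankMethodsBlind`, gen 21)**: past the power-format cactus wall
`6n^{2k} − 4 ≤ m^k`, every linear map `L` on `((ℂ^m)^{⊗k})^{⊗3}` with `rk L ≤ ρ` on rank-one tensors has
`rk L(((A,B,C)·pad_m⟨n,n,n⟩)^{⊠k}) ≤ ρ·m^k` for ALL `A, B, C ∈ Mat_m` — the maximum it takes on `{T^{⊠k} : T ∈ σ_m}`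
(`σ_m^{⊠k} ⊆ σ_{m^k}`); so no `σ_m`-equation of the Kronecker-power determinantal class (a `(ρ m^k + 1)`-minor of
`T ↦ L(T^{⊠k})`, any `k`, any `L`) separates the `GL_m³`-orbit of the pad from `σ_m` — hence none vanishes on `σ_m`
without vanishing on the orbit closure, which contains `𝔐 = \overline{GL_m³·pad_m⟨n,n,n⟩}`.  The pad is spelled
inline exactly as in the route file (`= padMM ℂ n m h` by `rfl`).  `k = 1` is item 30921.
[cite: Buczynski2026, Thm. 2 / Cor. 13 / §1.5; DolezalekMichalek2026, §3 and §5.1; GargMakamOliveiraWigderson2019, §1.4] -/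
theorem kroneckerRankMethodsBlind :
    ∀ (k n m : ℕ) (h : n * n ≤ m), 6 * n ^ (2 * k) - 4 ≤ m ^ k →
      ∀ (p q ρ : ℕ) (L : ((Fin k → Fin m) → (Fin k → Fin m) → (Fin k → Fin m) → ℂ) →ₗ[ℂ] Matrix (Fin p) (Fin q) ℂ),
        (∀ w u v : (Fin k → Fin m) → ℂ, (L (Literature.Computability.AlgebraicComplexity.triad w u v)).rank ≤ ρ) →
          ∀ A B C : Matrix (Fin m) (Fin m) ℂ,
            (L (Literature.Computability.AlgebraicComplexity.kroneckerPow
              (Literature.Computability.AlgebraicComplexity.actTensor A B C (fun a b c : Fin m =>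
                ∑ r : (Fin n × Fin n) × (Fin n × Fin n) × (Fin n × Fin n),
                  (if Fin.castLE h (finProdFinEquiv r.1) = a ∧ Fin.castLE h (finProdFinEquiv r.2.1) = b ∧
                      Fin.castLE h (finProdFinEquiv r.2.2) = c then (1 : ℂ) else 0) *
                    Literature.Computability.AlgebraicComplexity.matMulTensor ℂ n n n r.1 r.2.1 r.2.2)) k)).rank ≤
              ρ * m ^ k := by
  intro k n m h hm p q ρ L hρ A B C
  change (L (kroneckerPow (actTensor A B C (padMM ℂ n m h)) k)).rank ≤ ρ * m ^ k
  rcases Nat.eq_zero_or_pos k with rfl | hk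
  · -- `k = 0`: `t^{⊠0}` is the triad `1 ⊗ 1 ⊗ 1`, so the rank-one bound applies directly.
    rw [kroneckerPow_zero_eq_triad, pow_zero, mul_one]
    exact hρ _ _ _
  rcases Nat.eq_zero_or_pos n with rfl | hn
  · -- `n = 0`: the pad is the zero tensor and so is its `k`-th power (`k ≥ 1`).
    rw [padMM_zero, actTensor_zero, kroneckerPow_zero_tensor k hk, map_zero, Matrix.rank_zero]
    exact Nat.zero_le _
  · exact (rank_apply_kroneckerPow_actTensor_padMM_le hn h L hρ A B C).trans (Nat.mul_le_mul_left ρ hm)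

/-- The same past the coarser wall `6n^{2k} ≤ m^k` (the form in which the cells of `E` — `m ≥ n^τ`, `τ > 2`, `n`
large — meet rung R2^⊠: `m^k ≥ n^{τk} ≥ 6n^{2k}` once `n^{(τ−2)k} ≥ 6`). [bookkeeping] -/
theorem kroneckerRankMethodsBlind_of_six_pow_le {k n m : ℕ} (h : n * n ≤ m) (hm : 6 * n ^ (2 * k) ≤ m ^ k)
    {p q ρ : ℕ} (L : ((Fin k → Fin m) → (Fin k → Fin m) → (Fin k → Fin m) → ℂ) →ₗ[ℂ] Matrix (Fin p) (Fin q) ℂ)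
    (hρ : ∀ w u v : (Fin k → Fin m) → ℂ, (L (triad w u v)).rank ≤ ρ) (A B C : Matrix (Fin m) (Fin m) ℂ) :
    (L (kroneckerPow (actTensor A B C (padMM ℂ n m h)) k)).rank ≤ ρ * m ^ k :=
  kroneckerRankMethodsBlind k n m h ((Nat.sub_le _ _).trans hm) p q ρ L hρ A B C

/-- **Item 27417 `KroneckerRankMethodsBlind` holds** (the route decl, by the theorem above; the decl's text is this
file's `kroneckerRankMethodsBlind` verbatim). [cite: Buczynski2026, Thm. 2 / Cor. 13 / §1.5; DolezalekMichalek2026, §3] -/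
theorem kroneckerRankMethodsBlind_holds :
    Summit.MatrixMultiplication.MatrixMultiplication.Theses.ObstructionDescent.KroneckerRankMethodsBlind :=
  kroneckerRankMethodsBlind

/-- **Rung R2 is the case `k = 1`** (sanity link to item 30921): a linear rank method `L` on `ℂ^{m³}` induces the
Kronecker-power method `u ↦ L(u ∘ const)` of degree `1` … stated here only as the specialisation of the wall:
`6n² − 4 ≤ m` is the `k = 1` wall. [bookkeeping] -/
theorem wall_one (n m : ℕ) : (6 * n ^ (2 * 1) - 4 ≤ m ^ 1) ↔ (6 * n ^ 2 - 4 ≤ m) := by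
  rw [mul_one, pow_one]

end Summit.MatrixMultiplication.MatrixMultiplication.Theorems.ObstructionDescentKroneckerRankMethods

end
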